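import Summits.QuantumFields.YangMills.Theorems.BalabanUVNodesN21AtRRec13SepConstLayer
import Summits.QuantumFields.YangMills.Theorems.BalabanUVNodesN27AtReadingOfRecord13Sep

/-!
⁗ (SEPARATION-GUARD) EDITION of this seat's module 25 (‴ draft typed by g6, scratch rc 0, NOT FILED after WORDS-140 — this ⁗ edition is the first filing) — dag-lead WORDS-140 (cell bus l.16872): the ‴ item (K3‴ `SpineGivenEndpointR13`, stmt-QuantumFields-19912) is an
ASIDE after route rev 18∕19; the lane of record is K3⁗ `SpineGivenEndpointR13Sep` (stmt-QuantumFields-20292; `--kind proof --supports stmt-QuantumFields-20292 --as helper`).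
STATEMENTS = the ‴ statements under node00-def-T's `Record13.lean` v1.2 token map (`Provisos₁₃ ↦ Provisos₁₃Sep`, `datumOfRecord₁₃ ↦ datumOfRecord₁₃Sep`,
`IsRecordOfRecord₁₃C ↦ IsRecordOfRecord₁₃CSep`), node00-def-RR-2's key names (`IsDatumOfRecord₁₃C(On) ↦ IsDatumOfRecord₁₃CSep(On)`, `Node00.Record13DatumKeySep`), dag-n22-e's (T-RATE) names
(`RateReading₁₃ ∕ rateCarriersOfRecord₁₃ ∕ RRec₁₃(On) ∕ readingOfRecord₁₃ ↦ …₁₃Sep…`) and the spine-home names of dag-n27-c's twins of dag-n20-d's modules (`SpineReading₁₃ ∕ SRec₁₃(On)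
∕ sRec₁₃ ∕ keyed₁₃ ∕ homes₁₃ ∕ rec13C ↦ …Sep…`); PROOFS VERBATIM under the map; θ-only declarations (`Stage13Params`, `Admissible`, `ZtUnity`, `SlotsNondegenerate₁₃`, `unityNondeg₁₃`,
RR-1's `ne3ConstLayerOfRecord₁₁`, THE END's letters) are NOT renamed.  Generated by this seat's `sep/gen.py` (suffix-parametric: the same pass serves a later `Sep ↦ …` re-key).

# YM-DAG node N21 (= NE7c) AT dag-n22-e's STAGE-13 RATE READING OF RECORD `YMDAG.UVSplit.readingOfRecord₁₃Sep w1 ℓ₃ ne2 ne1` — module 24's constant-layer K5 faces and composite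
# INSTANTIATED at the NAMED reading (its NE3 component IS node00-def-RR-1's constant layer of record `ne3ConstLayerOfRecord₁₁ F N (ℓ₃ F)`, `readingOfRecord₁₃Sep_ne3 = rfl`), the in-edge
# N16 → N21 being the K4 stub `S_N16 (RRec₁₃Sep (readingOfRecord₁₃Sep …))` ∕ `S_N16 (RRec₁₃SepOn (readingOfRecord₁₃Sep …) Rg)` dag-n27-c's XL composite ALREADY carries as `h16` — the ₁₃ twin of
# module 11b (`BalabanUVNodesN21AtReadingOfRecord12`, p471808 ∕ p480933)

Track A of `YM-PLAN.md` (cell `pub-ymgap`, HUMAN RULING D-0062), node **N21**; R134 fan-out seat `pub-ymgap-dag-n21-d` (s2 = BY-NAME KNIT at the record), generation 6,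
module 25.  THEOREMS ONLY: 0 `def`, 0 `sorry`, standard axioms; COUNT-NEUTRAL; `--supports` the K3⁗ item `SpineGivenEndpointR13Sep` (stmt-QuantumFields-20292) as a helper.
`N`-generic, NO Theses import (restate-immune).  Imports module 24 `BalabanUVNodesN21AtRRec13SepConstLayer` (`exists_shellWeight_keyed₁₃Sep_of_constLayer`,
`exists_shellWeight_keyedOn₁₃Sep_of_constLayer`, `spine_rec13CSep_of_homes₁₃Sep_constLayer`) and dag-n27-c's XL `BalabanUVNodesN27AtReadingOfRecord13Sep` (p497236; brings dag-n22-e's 6″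
`BalabanUVNodesRateReadingOfRecord13Sep` — `readingOfRecord₁₃Sep`, `readingOfRecord₁₃Sep_ne3` — and dag-n17-a's `YMDAG.N17.s_N17_of_D4_N18`).  Restates nothing; cites by name.

WHAT IS PROVED ([bookkeeping]; ONE application BY NAME with `hconst := fun … ↦ rfl`).  NOTE (gate dedup): the K5 ∃-weight faces at the reading of record are 24⁗'s
`exists_shellWeight_keyed₁₃Sep_of_constLayer` ∕ `exists_shellWeight_keyedOn₁₃Sep_of_constLayer` AT `𝔯 := readingOfRecord₁₃Sep w1 ℓ₃ ne2 ne1`, `o F := ne3ConstLayerOfRecord₁₁ F N (ℓ₃ F)`,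
`hconst := fun … ↦ rfl` — by `exact`, so they are NOT re-declared here (the gate's `dedup.landed` reads them as the same declaration); only the composite is new.
* (cited, not declared) the K5 faces — at every admissible Stage-13 tuple with provisos and every `(g₀, os)`, SOME `Wsh` with `ShellWeightBound (cr F θ hP g₀ os) … Wsh`,
  from: the K4 stub `S_N16 (RRec₁₃Sep (readingOfRecord₁₃Sep w1 ℓ₃ ne2 ne1))` (N16 BY NAME at the reading of record), THE END's proviso `InEndRegime` at RR-1's layer of record with letters
  `ℓ₃ F`, the regularity numeral `512·5·8·L²·(ℓ₃ F).b ≤ 1` and `0 < (ℓ₃ F).Λ₂′`, and NODE O's term-object readings `hread` of the carriers (two level ledgers ([dict] + (M1)), live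
  windows, `D ≤ D̄`, threshold widths at a geometric rate, a threshold unit `ε′`, a flux letter `cg`, the two [dict] clauses against the (42)-constrained minimisers on RR-1's
  physical unit torus); `exists_shellWeight_keyedOn₁₃Sep_readingOfRecord₁₃Sep` — the same at the REGIME-RESTRICTED home `RRec₁₃SepOn (readingOfRecord₁₃Sep …) Rg`, at guarded tuples.
* §2 `spine_rec13CSep_at_readingOfRecord₁₃Sep_constLayer` — dag-n27-c XL's `spine_rec13CSep_at_readingOfRecord₁₃Sep` (five rate stubs + (D4) at `RRec₁₃Sep (readingOfRecord₁₃Sep …)`, N17 eliminated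
  by `YMDAG.N17.s_N17_of_D4_N18`, `S_N27x`, `S_N20` at `SRec₁₃Sep cr`, the home-keyed N19′ edge) with THE N21 SLOT `h21 : S_N21 (SRec₁₃Sep cr)` DISCHARGED (module 24 §4 via module 21c's
  ∃-weight form): N16's `h16` serves twice (rate stub AND N21's in-edge); what N21 adds to the hypothesis list is the proviso at the layer, the two numerals and `hread` — nothing else.

HONEST FRAMING (binding).  Every K4 ∕ K5 stub, the N19′ edge, `InEndRegime`, the ledgers ((M1) NOT PRINTED + [dict], incl. the (0.4)∕(42) averaging transfer — GAP-STATED of record),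
live windows, `D̄`, threshold widths and the [dict] clauses are HYPOTHESES, displayed; `cr` is a PARAMETER (no reading of Bałaban's dressed two-run expansion exists in the tree —
NODE O); the reading of record's W1 towers, `ne2`, `ne1` are residual DATA inside named containers; no inhabitant of `IsDatumOfRecord₁₃CSep` claimed (K0‴ open); nothing of Bałaban's
asserted; NE7 ∕ NE7b ∕ NE7c NOT PRINTED for d = 4 and NOT PROVED; **N21 NOT discharged**, N27 NOT discharged, K3‴ NOT claimed; typed 28∕28, discharged count untouched; one finite
four-torus programme at fixed `ε` — NOT ℝ⁴, NOT infinite volume, NOT OS, NOT a mass gap, NOT Clay.  No decl below carries a cite tag.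
-/

set_option autoImplicit false

noncomputable section

open scoped BigOperators Matrix Matrix.Norms.L2Operator

namespace Summit.QuantumFields.YangMills.Theorems.N21AtReadingOfRecord13Sep

open Literature.MathematicalPhysics.QuantumFieldTheory.Balaban1983to89
open Literature.MathematicalPhysics.QuantumFieldTheory.Balaban1983to89.T4Continuum (T4Family ULoop FiniteEpsData)
open B7Prop1Explicit B7Prop2Explicit
open T4AveragingDeficitWall (Plane)
open T4WeightBudget (RelWeightBound)
open T4IndicatorShell (ShellWeightBound)
open T4ShellMeasureLevels (LevelLedger LiveWindow)
open Summit.QuantumFields.BalabanUV.T4Continuum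
open Summit.QuantumFields.BalabanUV.T4Continuum.Spine
open MinimalActionSandwich (IsMinimiser)
open MinimalActionRate (Regular sfClass)
open MinimalActionRefine (RegularSup)
open YMDAG.UVSplit
open Summit.QuantumFields.YangMills.BalabanUVNodes.N16Regime (InEndRegime)
open N21AtRRec13SepConstLayer (exists_shellWeight_keyed₁₃Sep_of_constLayer exists_shellWeight_keyedOn₁₃Sep_of_constLayer spine_rec13CSep_of_homes₁₃Sep_constLayer)
open Node00 (NE3Letters₁₁ NE2Objects₁₁ Stage13Params IsDatumOfRecord₁₃CSep IsRecordOfRecord₁₃CSep datumOfRecord₁₃Sep ne3ConstLayerOfRecord₁₁)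

variable {N : ℕ} [NeZero N] (cr : SpineReading₁₃Sep N)
  (w1 : (F : T4Family) → (θ : Stage13Params F N) → Node00.W1.ReadingData F (Node00.MatA N) θ.τ9.M) (ℓ₃ : T4Family → NE3Letters₁₁)
  (ne2 : (F : T4Family) → Stage13Params F N → (ℕ → ℝ) → List (ULoop F) → ℕ → NE2Objects₁₁)
  (ne1 : (F : T4Family) → Stage13Params F N → (ℕ → ℝ) → List (ULoop F) → NE1pCarriers)
  (hreg : ∀ F : T4Family, InEndRegime (ne3OfRecord₁₁ F (ne3ConstLayerOfRecord₁₁ F N (ℓ₃ F))))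
  (hnum : ∀ F : T4Family, 512 * (4 + 1) * (4 + 4) * (F.L : ℝ) ^ 2 * (ℓ₃ F).b ≤ 1 ∧ 0 < (ℓ₃ F).Λ₂')

/-! ## §1 dag-n27-c XL⁗'s composite at the reading of record with the N21 slot discharged (the K5 faces are 24⁗'s by `exact`) -/

section Canonical

variable (hS : S_N16 (RRec₁₃Sep (readingOfRecord₁₃Sep w1 ℓ₃ ne2 ne1)))
  (hread : ∀ (F : T4Family) (θ : Stage13Params F N) (hP : θ.Provisos₁₃Sep F N), θ.Admissible F N → ∀ (g₀ : ℕ → ℝ) (os : List (ULoop F)),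
    ∃ (ε' cg : ℝ) (σA σB : Type) (SA : ℕ → Finset σA) (SB : ℕ → Finset σB) (pieceA : ℕ → ℝ → σA → (cr F θ hP g₀ os).ι → ℝ)
      (pieceB : ℕ → ℝ → σB → (cr F θ hP g₀ os).ι → ℝ) (lvlA : ℕ → σA → ℕ) (lvlB : ℕ → σB → ℕ) (DA ρA DB ρB τA τB : ℕ → ℝ) (N₁ : ℕ)
      (νbar Dbar c₂ ϑ₂ : ℝ),
      0 < ε' ∧ 0 ≤ cg ∧
      LevelLedger (cr F θ hP g₀ os).l₀ (cr F θ hP g₀ os).T (cr F θ hP g₀ os).A (cr F θ hP g₀ os).shA SA pieceA lvlA DA ρA ∧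
      LevelLedger (cr F θ hP g₀ os).l₀ (cr F θ hP g₀ os).T (cr F θ hP g₀ os).B (cr F θ hP g₀ os).shB SB pieceB lvlB DB ρB ∧
      LiveWindow SA lvlA N₁ νbar ∧ LiveWindow SB lvlB N₁ νbar ∧ (∀ j, DA j ≤ Dbar) ∧ (∀ j, DB j ≤ Dbar) ∧
      0 ≤ c₂ ∧ 0 ≤ ϑ₂ ∧ ϑ₂ < 1 ∧ (∀ j, τA j ≤ c₂ * ϑ₂ ^ j) ∧ (∀ j, τB j ≤ c₂ * ϑ₂ ^ j) ∧
      (∀ j, 1 ≤ j → ∀ x : ℝ,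
        (∀ (V UA UB : B7Prop1Explicit.Site 4 → Fin 4 → (Matrix (Fin N) (Fin N) ℂ)ˣ) (z : B7Prop1Explicit.Site 4) (μ ν : Fin 4) (t : ℝ),
          V ∈ (ne3ConstLayerOfRecord₁₁ F N (ℓ₃ F)).dom → IsMinimiser 4 (sfClass 4 F.L (ne3ConstLayerOfRecord₁₁ F N (ℓ₃ F)).Nper (ne3ConstLayerOfRecord₁₁ F N (ℓ₃ F)).ε) F.L (ne3ConstLayerOfRecord₁₁ F N (ℓ₃ F)).Nper j V UA →
          IsMinimiser 4 (sfClass 4 F.L (ne3ConstLayerOfRecord₁₁ F N (ℓ₃ F)).Nper (ne3ConstLayerOfRecord₁₁ F N (ℓ₃ F)).ε) F.L (ne3ConstLayerOfRecord₁₁ F N (ℓ₃ F)).Nper (j + 1) V UB → Regular 4 F.L (ne3ConstLayerOfRecord₁₁ F N (ℓ₃ F)).Nper (ne3ConstLayerOfRecord₁₁ F N (ℓ₃ F)).b (ne3ConstLayerOfRecord₁₁ F N (ℓ₃ F)).g (j + 1) UB →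
          ε' * ((F.L : ℝ)⁻¹) ^ (2 * j) ≤ t →
          |‖((hol UA z (plaqWord μ ν) : (Matrix (Fin N) (Fin N) ℂ)ˣ) : Matrix (Fin N) (Fin N) ℂ) - 1‖
              - ‖((hol (rescale F.L (bavg F.L UB)) z (plaqWord μ ν) : (Matrix (Fin N) (Fin N) ℂ)ˣ) : Matrix (Fin N) (Fin N) ℂ) - 1‖| / t ≤ x) →
        ρA j ≤ x + τA j) ∧
      (∀ j, 1 ≤ j → ∀ x : ℝ,
        (∀ (V UA UB : B7Prop1Explicit.Site 4 → Fin 4 → (Matrix (Fin N) (Fin N) ℂ)ˣ) (z : B7Prop1Explicit.Site 4) (π : Plane 4)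
          (r₀ : Fin 4 → Fin F.L) (i₀ j₀ : ℕ) (t : ℝ),
          V ∈ (ne3ConstLayerOfRecord₁₁ F N (ℓ₃ F)).dom → IsMinimiser 4 (sfClass 4 F.L (ne3ConstLayerOfRecord₁₁ F N (ℓ₃ F)).Nper (ne3ConstLayerOfRecord₁₁ F N (ℓ₃ F)).ε) F.L (ne3ConstLayerOfRecord₁₁ F N (ℓ₃ F)).Nper j V UA →
          IsMinimiser 4 (sfClass 4 F.L (ne3ConstLayerOfRecord₁₁ F N (ℓ₃ F)).Nper (ne3ConstLayerOfRecord₁₁ F N (ℓ₃ F)).ε) F.L (ne3ConstLayerOfRecord₁₁ F N (ℓ₃ F)).Nper (j + 1) V UB → Regular 4 F.L (ne3ConstLayerOfRecord₁₁ F N (ℓ₃ F)).Nper (ne3ConstLayerOfRecord₁₁ F N (ℓ₃ F)).b (ne3ConstLayerOfRecord₁₁ F N (ℓ₃ F)).g (j + 1) UB →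
          RegularSup 4 F.L (ne3ConstLayerOfRecord₁₁ F N (ℓ₃ F)).Nper (ne3ConstLayerOfRecord₁₁ F N (ℓ₃ F)).b cg (j + 1) UB → i₀ < F.L → j₀ < F.L → ε' * ((F.L : ℝ)⁻¹) ^ (2 * j) ≤ t →
          |‖((hol UA z (plaqWord π.1.1 π.1.2) : (Matrix (Fin N) (Fin N) ℂ)ˣ) : Matrix (Fin N) (Fin N) ℂ) - 1‖
              - (F.L : ℝ) ^ 2 * ‖((hol UB ((F.L : ℤ) • z + boxVec F.L r₀ + (i₀ : ℤ) • e π.1.1 + (j₀ : ℤ) • e π.1.2)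
                  (plaqWord π.1.1 π.1.2) : (Matrix (Fin N) (Fin N) ℂ)ˣ) : Matrix (Fin N) (Fin N) ℂ) - 1‖| / t ≤ x) →
        ρB j ≤ x + τB j))

include hreg hnum hS hread


/-- **N27 = B5 AT THE STAGE-13 RECORD FROM THE STUBS AT THE CANONICAL HOME OF THE READING OF RECORD, N17 ELIMINATED, THE N21 SLOT SUPPLIED BY THE CONSTANT LAYER OF RECORD.**
dag-n27-c XL's `spine_rec13CSep_at_readingOfRecord₁₃Sep` — N14 · N15 · N16 · N18 · N22 and the (D4) read-out stub at `RRec₁₃Sep (readingOfRecord₁₃Sep w1 ℓ₃ ne2 ne1)` (N17 by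
`YMDAG.N17.s_N17_of_D4_N18`), `S_N27x ₁₃C (SRec₁₃Sep cr)`, `S_N20 (SRec₁₃Sep cr)`, the home-keyed N19′ edge — with `h21 : S_N21 (SRec₁₃Sep cr)` DISCHARGED by §1 (module 24 §4 through module
21c's ∃-weight form; the reading is re-weighted, the conclusion does not mention it): N16's `h16` serves twice; N21 contributes THE END's proviso at the layer of record, the two
numerals and NODE O's term-object readings `hread` — nothing else.  CONCLUSION `Spine ₁₃C`.  Every binder a HYPOTHESIS (0∕1 today); N21 ∕ N27 NOT discharged; K3‴ NOT claimed.
[bookkeeping] -/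
theorem spine_rec13CSep_at_readingOfRecord₁₃Sep_constLayer
    (h14 : S_N14 (RRec₁₃Sep (readingOfRecord₁₃Sep w1 ℓ₃ ne2 ne1))) (h15 : S_N15 (RRec₁₃Sep (readingOfRecord₁₃Sep w1 ℓ₃ ne2 ne1)))
    (h18 : S_N18 (RRec₁₃Sep (readingOfRecord₁₃Sep w1 ℓ₃ ne2 ne1))) (h22 : S_N22 (RRec₁₃Sep (readingOfRecord₁₃Sep w1 ℓ₃ ne2 ne1)))
    (hD4 : S_D4 (RRec₁₃Sep (readingOfRecord₁₃Sep w1 ℓ₃ ne2 ne1)))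
    (hx' : S_N27x (fun F D w => IsRecordOfRecord₁₃CSep F N D w) (SRec₁₃Sep cr)) (h20 : S_N20 (SRec₁₃Sep cr))
    (h19 : ∀ (F : T4Family) (θ : Stage13Params F N) (hP : θ.Provisos₁₃Sep F N), θ.Admissible F N → ∀ (g₀ : ℕ → ℝ) (os : List (ULoop F))
      (h : IsDatumOfRecord₁₃CSep F N (datumOfRecord₁₃Sep F N θ hP)) (k : ℕ),
      RatesAt (datumOfRecord₁₃Sep F N θ hP) (rateCarriersOfRecord₁₃Sep (readingOfRecord₁₃Sep w1 ℓ₃ ne2 ne1) F h.params h.provisos g₀ os k) → letI := (cr F θ hP g₀ os).dec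
        ∃ δ : ℕ → ℝ, NE7.Core (cr F θ hP g₀ os).l₀ (cr F θ hP g₀ os).vol (cr F θ hP g₀ os).T (cr F θ hP g₀ os).Bad
          (fun K t τ => (cr F θ hP g₀ os).A K t τ - (cr F θ hP g₀ os).shA K t τ) (fun K t τ => (cr F θ hP g₀ os).B K t τ - (cr F θ hP g₀ os).shB K t τ) δ ∧
          Summable δ) :
    Spine (N := N) fun F D w => IsRecordOfRecord₁₃CSep F N D w :=
  spine_rec13CSep_of_homes₁₃Sep_constLayer cr (readingOfRecord₁₃Sep w1 ℓ₃ ne2 ne1) (fun F => ne3ConstLayerOfRecord₁₁ F N (ℓ₃ F)) (fun _ _ _ _ _ _ => rfl) hS hreg hnum hread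
    h14 h15 (YMDAG.N17.s_N17_of_D4_N18 _ hD4 h18) h18 h22 hx' h20 h19

end Canonical


end Summit.QuantumFields.YangMills.Theorems.N21AtReadingOfRecord13Sep

end
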